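import Mathlib.MeasureTheory.Constructions.Pi
import Mathlib.MeasureTheory.Integral.Bochner.Basic
import Mathlib.MeasureTheory.Measure.WithDensity
import Mathlib.MeasureTheory.Measure.Haar.InnerProductSpace
import Mathlib.MeasureTheory.Measure.Lebesgue.EqHaar
import Mathlib.Analysis.InnerProductSpace.PiL2
import Mathlib.Analysis.SpecialFunctions.Exp
import Mathlib.Probability.Moments.Variance
import Mathlib.Topology.MetricSpace.Bounded
import HarnessLib

/-!
# Spectral gap of the Kawasaki-type (move-one-particle) dynamics of the canonical continuum gas
# (Boudou–Caputo–Dai Pra–Posta 2006, §5)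

Topic `Literature/MathematicalPhysics/StatisticalMechanics`. One NAMED FACT, filed by a grounder for
`Summit.AtomisticToContinuum.HydrodynamicLimit.Theses.OneSphereInfluence.HardCorePoincare`
(item stmt-AtomisticToContinuum-13619: an `N`-uniform Efron–Stein / Poincaré inequality for the
canonical hard-sphere local Gibbs law at small packing), whose HOMOGENEOUS core it is.

## Source (held: arXiv:math/0505533 = J. Funct. Anal. 232 (2006) 222–258)

A.-S. Boudou, P. Caputo, P. Dai Pra, G. Posta, *Spectral gap estimates for interacting particle
systems via a Bochner-type identity*, §5 "Kawasaki-type dynamics in the continuum" (arXiv pp. 12–13).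
Setting (verbatim): `Λ` "a bounded Borel subset of `ℝ^d` of nonzero Lebesgue measure"; `φ : ℝ^d → [0,+∞)`
"a nonnegative measurable and even function" ("everything works with minor modifications for
`φ : ℝ^d → [0,+∞]` allowing 'hardcore repulsion'"); free boundary condition; for `N ∈ ℕ`, `β > 0`
"the canonical Gibbs measure in the finite volume `Λ` with inverse temperature `β`" is
`ν_Λ^N[f] = (Z_Λ^N)⁻¹ ∫_{Λ^N} dw/|Λ|^N e^{-βH(w)} f(w)`, `H(w) = Σ_{i<j} φ(w_i - w_j)`, functions on
`N`-point configurations being identified with symmetric functions on `Λ^N`. Generator: "moving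
particles `x ∈ η` to a point `z ∈ Λ` with infinitesimal rate `|Λ|⁻¹ e^{-β(H^{xz}(η)-H^{x-}(η))} dz`",
`H^{xz}(η) - H^{x-}(η) = Σ_{y ∈ η∖{x}} φ(y - z)`; Dirichlet form
`𝓔(f,f) = ½ ∫_Λ dz/|Λ| ν_Λ^N[Σ_{x∈η} e^{-β(H^{xz}-H^{x-})} (∇_{xz} f)²]`.
THEOREM (§5, arXiv p. 13): `gap(𝓛) ≥ 1 - ε₁ - ε₂` with
`ε₁ = sup_{η ∈ S_{N-1}} ∫_Λ dv/|Λ| (1 - e^{-β Σ_{x∈η} φ(v-x)})`,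
`ε₂ = 2(N-1) sup_{z∈Λ} ∫_Λ dv/|Λ| (1 - e^{-βφ(v-z)})`.
COROLLARY (§5, arXiv p. 13): if `ε(β) := ∫_{ℝ^d} (1 - e^{-βφ(x)}) dx < ∞` then "for every bounded
Borel set `Λ ⊂ ℝ^d`, `N ∈ ℕ`: `gap(𝓛) ≥ 1 - 3(N-1) ε(β)/|Λ|`."  Here `gap(𝓛)` is the infimum of
`𝓔(f,f)/Var(f)` over the core of bounded functions (§2 of the paper), so the corollary is the
Poincaré inequality `(1 - 3(N-1)ε(β)/|Λ|) Var_{ν}(f) ≤ 𝓔(f,f)` for bounded measurable symmetric `f`.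

## Faithfulness / design

* Stated for finite-valued `φ ≥ 0` exactly as printed (the hard-core case `φ = +∞·𝟙_{|x|<r}`,
  `ε(β) = |B_r|`, is the authors' "minor modifications" remark and is NOT asserted here; users reach
  it by monotone approximation `φ_K = K·𝟙_{|x|<r}`, `ε(φ_K) ≤ |B_r|` uniformly in `K`).
* Labelled coordinates `w : Fin N → ℝ^d` (the paper's own computation is in labelled variables
  `w ∈ Λ^N`); `f` is required symmetric, as printed. `β ≥ 0` (the paper takes `β > 0`; `β = 0` is
  the trivial product case with gap `1`, also covered by the printed formula) — we keep `0 < β`.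
* Reference measure `(Leb|_Λ)^{⊗N}`; the canonical law is its normalised `e^{-βH}`-reweighting,
  written with `withDensity`; `Z > 0` and `< ∞` hold automatically (`0 < e^{-βH} ≤ 1`, `0 < |Λ| < ∞`)
  and are not hypotheses. Variance is Mathlib's `ProbabilityTheory.variance`.
* What the consumer must still add (recorded on the item): torus instead of `Λ ⊂ ℝ^d`, hard core,
  Maxwellian velocity marks (tensorisation), inhomogeneous one-body activity `a(x)` (NOT in print),
  and the comparison `𝓔 ≤ Σ_i E Var(f | w_{-i})` of Dirichlet forms (uniform proposal on `Λ` vs.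
  heat-bath resampling: `|A_i(w)| ≤ |Λ|`).
-/

noncomputable section

open MeasureTheory

namespace Literature.MathematicalPhysics.StatisticalMechanics

/-- NAMED FACT — **Boudou–Caputo–Dai Pra–Posta 2006, §5, Corollary (spectral gap of the
Kawasaki-type dynamics of the canonical continuum gas at small density)**: for a nonnegative even
measurable pair potential `φ` on `ℝ^d` with `ε(β) = ∫ (1 - e^{-βφ}) < ∞`, a bounded Borel `Λ` of
positive measure, `N` particles and the canonical Gibbs measure `ν = Z⁻¹ e^{-βH(w)} dw/|Λ|^N`,
`H(w) = Σ_{i<j} φ(w_i - w_j)`, every bounded measurable symmetric `f : Λ^N → ℝ` satisfies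
`(1 - 3(N-1)ε(β)/|Λ|) · Var_ν(f) ≤ 𝓔(f,f) := ½ ∫_Λ dz/|Λ| E_ν[Σ_i e^{-β Σ_{j≠i} φ(w_j - z)} (f(w^{i→z}) - f(w))²]`
("`gap(𝓛) ≥ 1 - 3(N-1)ε(β)/|Λ|`"). Users take `(h : BCDP2006_canonicalGas_gap)`; grounds the
homogeneous core of `Summit.AtomisticToContinuum.HydrodynamicLimit.Theses.OneSphereInfluence.HardCorePoincare`.
[cite: BoudouCaputoDaiPraPosta2006, §5 Corollary (arXiv:math/0505533 p. 13)] -/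
def BCDP2006_canonicalGas_gap : Prop :=
  ∀ (d N : ℕ) (φ : EuclideanSpace ℝ (Fin d) → ℝ) (β : ℝ) (Λ : Set (EuclideanSpace ℝ (Fin d))),
    Measurable φ → (∀ x, 0 ≤ φ x) → (∀ x, φ (-x) = φ x) → 0 < β →
    Integrable (fun x => 1 - Real.exp (-(β * φ x))) (volume : Measure (EuclideanSpace ℝ (Fin d))) →
    MeasurableSet Λ → Bornology.IsBounded Λ → volume Λ ≠ 0 →
    let ε : ℝ := ∫ x, (1 - Real.exp (-(β * φ x))) ∂(volume : Measure (EuclideanSpace ℝ (Fin d)))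
    let vol : ℝ := (volume Λ).toReal
    -- pair energy and the canonical Gibbs measure on `Λ^N` (labelled coordinates)
    let H : (Fin N → EuclideanSpace ℝ (Fin d)) → ℝ :=
      fun w => ∑ i : Fin N, ∑ j : Fin N, if i < j then φ (w i - w j) else 0
    let ref : Measure (Fin N → EuclideanSpace ℝ (Fin d)) :=
      Measure.pi fun _ : Fin N => (volume : Measure (EuclideanSpace ℝ (Fin d))).restrict Λ
    let wt : (Fin N → EuclideanSpace ℝ (Fin d)) → ℝ := fun w => Real.exp (-(β * H w))
    let Z : ℝ := ∫ w, wt w ∂ref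
    let ν : Measure (Fin N → EuclideanSpace ℝ (Fin d)) :=
      (ENNReal.ofReal Z⁻¹) • ref.withDensity (fun w => ENNReal.ofReal (wt w))
    -- Dirichlet form of the move-one-particle dynamics with uniform proposal on `Λ`
    let dirichlet : ((Fin N → EuclideanSpace ℝ (Fin d)) → ℝ) → ℝ := fun f =>
      (1 / 2) * ∫ z in Λ, vol⁻¹ *
        (∫ w, (∑ i : Fin N, Real.exp (-(β * ∑ j : Fin N, if j ≠ i then φ (w j - z) else 0)) *
            (f (Function.update w i z) - f w) ^ 2) ∂ν) ∂(volume : Measure (EuclideanSpace ℝ (Fin d)))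
    ∀ f : (Fin N → EuclideanSpace ℝ (Fin d)) → ℝ, Measurable f → (∃ C, ∀ w, |f w| ≤ C) →
      (∀ (e : Equiv.Perm (Fin N)) (w : Fin N → EuclideanSpace ℝ (Fin d)), f (w ∘ e) = f w) →
      (1 - 3 * (N - 1 : ℝ) * ε / vol) * ProbabilityTheory.variance f ν ≤ dirichlet f

end Literature.MathematicalPhysics.StatisticalMechanics

end
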